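import Mathlib
import HarnessLib
import Summits.QuantumFields.YangMills.Theorems.MirrorModularBoostsHypercubicLimitPlaneLimitsDefs
import Summits.QuantumFields.YangMills.Theorems.LangevinControlUVOSLegsFromFemtoAndGapStubAssemblyLatticeDist
import Summits.QuantumFields.YangMills.Theorems.LangevinControlUVOSLegsFromFemtoAndGapStubAssemblyStrings
import Literature.MathematicalPhysics.QuantumFieldTheory.LatticeGaugeProofs

/-!
# Line `Sketch` (coupling response): the plane-string distribution on real tensors

Helper file for crux `stmt-QuantumFields-16154` (`HypercubicLimit`), line `Sketch`, sub-goal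
`planeDist_eq_integral_prod_planeField` (Z3a): on a tensor `F = f₁ ⊗ ⋯ ⊗ fₙ` of REAL one-point test functions the
renormalised lattice distribution `planeDist r sch k n q` of the plane string `q` is the Wilson moment of the product
of the smeared plane fields, `planeDist r sch k n q F = ∫ ∏ᵢ Φ^{qᵢ}_k(fᵢ) dμ_k`.

The proof is the string version of toolkit III's `latticeSchwinger_eq_latticeDist`
(`OSLegsFromFemtoAndGap`): expand `∏ᵢ (c a⁴ Σₓ fᵢ(a x)(Oᵢ(τₓŨ) − m))` as `(c a⁴)ⁿ Σ_{x ∈ boxⁿ} (∏ᵢ fᵢ(a xᵢ)) ∏ᵢ (Oᵢ − m)`,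
exchange the finite sum with the integral, and match with `latticeDistStr_apply`.
References: Glimm–Jaffe 1987 §6.1; Osterwalder–Schrader 1973 §2.
-/

noncomputable section

open scoped SchwartzMap BigOperators
open MeasureTheory Filter Topology
open Literature.MathematicalPhysics.AQFT Literature.MathematicalPhysics.QuantumLattice
open Literature.MathematicalPhysics.QuantumFieldTheory
open Literature.Probability.LatticeModels (box Site)
open Summit.QuantumFields.YangMills.Theorems.OSLegsFromFemtoAndGap

namespace Summit.QuantumFields.YangMills.Cruxes.HypercubicLimit.CouplingResponse

section Helpers

variable {G : Type} [Group G] [TopologicalSpace G] [IsTopologicalGroup G] [CompactSpace G]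
  [MeasurableSpace G] [BorelSpace G]

/-- Integrability of the centred products of a STRING of bounded measurable local observables (one observable and
one additive normalisation per insertion) under the (probability) Wilson measure, read through the periodic lift.
[folklore] -/
theorem integrable_prod_obsStr (r : LatticeRep G) (β : ℝ) (L : ℕ) {n : ℕ} (s : Fin n → YMSpecies G)
    (m : Fin n → ℝ) (x : Fin n → Site 4) :
    Integrable (fun U : GaugeConfig 4 (2 * L + 1) G =>
        ∏ i, ((s i).F (configShift (-(x i)) (torusLift (2 * L + 1) U)) - m i))
      (wilsonMeasure (d := 4) (L := 2 * L + 1) r.ρ β) := by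
  -- adapted from OSLegsFromFemtoAndGap.integrable_prod_obs (toolkit III, constant string)
  haveI := isProbabilityMeasure_wilsonMeasure (d := 4) (L := 2 * L + 1) r.ρ r.continuous β
  choose C hC using fun i => (s i).bounded
  have hmeas : ∀ i, Measurable fun U : GaugeConfig 4 (2 * L + 1) G =>
      (s i).F (configShift (-(x i)) (torusLift (2 * L + 1) U)) - m i := fun i =>
    ((s i).measurable.comp ((configShift _).measurable.comp (measurable_torusLift _))).sub measurable_const
  refine Integrable.of_bound (C := ∏ i, (|C i| + |m i|))
    (Finset.measurable_prod _ fun i _ => hmeas i).aestronglyMeasurable ?_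
  refine Eventually.of_forall fun U => ?_
  rw [Real.norm_eq_abs, Finset.abs_prod]
  exact Finset.prod_le_prod (fun _ _ => abs_nonneg _) fun i _ =>
    (abs_sub _ _).trans (add_le_add ((hC i _).trans (le_abs_self (C i))) le_rfl)

/-- The product of the smeared plane fields of a string, expanded:
`∏ᵢ Φ^{qᵢ}_k(fᵢ)(U) = (c_k a_k⁴)ⁿ Σ_{x ∈ (box L_k)ⁿ} (∏ᵢ fᵢ(a_k xᵢ)) ∏ᵢ (p_{qᵢ}(τ_{xᵢ}Ũ) − m_k/6)`. [folklore] -/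
theorem prod_planeField_eq_mul_sum (r : LatticeRep G) (sch : SpeciesScheme (YMSpecies G)) (k : ℕ) {n : ℕ}
    (q : Fin n → Plane) (f : Fin n → 𝓢(EuclideanSpace ℝ (Fin 4), ℝ)) (U : GaugeConfig 4 (sch.side k) G) :
    ∏ i, planeField r sch k (q i) (f i) U =
      (sch.c r.curvature k * sch.a k ^ 4) ^ n *
        ∑ x ∈ Fintype.piFinset (fun _ : Fin n => box 4 (sch.L k)),
          (∏ i, f i (sch.a k • siteToE (x i))) *
            ∏ i, ((planeSpecies r (q i)).F (configShift (-(x i)) (torusLift (sch.side k) U)) -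
              sch.m r.curvature k / 6) := by
  -- adapted from OSLegsFromFemtoAndGap.latticeSchwinger_eq_latticeDist (toolkit III), step `hprod`
  simp only [planeField, smearedLatticeField_eq_mul_sum]
  rw [Finset.prod_mul_distrib, Finset.prod_const, Finset.card_univ, Fintype.card_fin]
  congr 1
  rw [Finset.prod_univ_sum]
  refine Finset.sum_congr rfl fun x _ => ?_
  rw [← Finset.prod_mul_distrib]

end Helpers

/-- **Registered sub-goal `planeDist_eq_integral_prod_planeField` (line `Sketch`, Z3a).**  On a tensor
`F = f₁ ⊗ ⋯ ⊗ fₙ` of real one-point test functions, the renormalised lattice distribution of the plane string `q` at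
step `k` is the Wilson moment of the product of the smeared plane fields:
`planeDist r sch k n q F = ∫ ∏ᵢ Φ^{qᵢ}_k(fᵢ) dμ_k`. [folklore] -/
theorem planeDist_eq_integral_prod_planeField : ∀ (G : Type) [Group G] [TopologicalSpace G] [IsTopologicalGroup G] [CompactSpace G] [MeasurableSpace G] [BorelSpace G] (r : LatticeRep G) (sch : SpeciesScheme (YMSpecies G)) (k n : ℕ) (q : Fin n → Plane) (f : Fin n → 𝓢(EuclideanSpace ℝ (Fin 4), ℝ)) (F : 𝓢((Fin n → EuclideanSpace ℝ (Fin 4)), ℂ)), IsTensorOf F (fun i => ofRealTest (f i)) → planeDist r sch k n q F = ((∫ U, ∏ i, planeField r sch k (q i) (f i) U ∂(wilsonAt r sch k) : ℝ) : ℂ) := by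
  -- adapted from OSLegsFromFemtoAndGap.latticeSchwinger_eq_latticeDist (toolkit III): per-insertion observables
  -- `(planeSpecies r (q i)).F`, common counterterm `m_k/6`, `latticeDistStr` in place of `latticeDist`
  intro G _ _ _ _ _ _ r sch k n q f F hF
  classical
  -- the right-hand side: expand the product of sums and integrate termwise
  have hfun : (fun U : GaugeConfig 4 (sch.side k) G => ∏ i, planeField r sch k (q i) (f i) U) =
      fun U => (sch.c r.curvature k * sch.a k ^ 4) ^ n *
        ∑ x ∈ Fintype.piFinset (fun _ : Fin n => box 4 (sch.L k)),
          (∏ i, f i (sch.a k • siteToE (x i))) *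
            ∏ i, ((planeSpecies r (q i)).F (configShift (-(x i)) (torusLift (sch.side k) U)) -
              sch.m r.curvature k / 6) :=
    funext (prod_planeField_eq_mul_sum r sch k q f)
  have hint : ∀ x : Fin n → Site 4, Integrable (fun U : GaugeConfig 4 (sch.side k) G =>
      ∏ i, ((planeSpecies r (q i)).F (configShift (-(x i)) (torusLift (sch.side k) U)) -
        sch.m r.curvature k / 6)) (wilsonAt r sch k) := fun x =>
    integrable_prod_obsStr r (sch.β k) (sch.L k) (fun i => planeSpecies r (q i))
      (fun _ => sch.m r.curvature k / 6) x
  rw [hfun, integral_const_mul, integral_finsetSum _ (fun x _ => (hint x).const_mul _)]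
  simp only [integral_const_mul]
  -- the left-hand side
  simp only [planeDist, FunLike.coe_smul, Pi.smul_apply, smul_eq_mul, latticeDistStr_apply]
  push_cast
  simp only [Finset.mul_sum]
  refine Finset.sum_congr rfl fun x _ => ?_
  have hFx : F (fun i => sch.a k • siteToE (x i)) = ∏ i, ((f i (sch.a k • siteToE (x i)) : ℝ) : ℂ) := by
    rw [hF]
    simp only [ofRealTest_apply]
  have hW : (∫ U : GaugeConfig 4 (sch.side k) G,
      ∏ i, ((planeSpecies r (q i)).F (configShift (-(x i)) (torusLift (sch.side k) U)) -
        sch.m r.curvature k / 6) ∂(wilsonAt r sch k)) =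
      torusMomentStr r.ρ (sch.β k) (sch.L k) (fun i => (planeSpecies r (q i)).F)
        (fun _ => sch.m r.curvature k / 6) x := rfl
  rw [hFx, hW]
  ring

end Summit.QuantumFields.YangMills.Cruxes.HypercubicLimit.CouplingResponse

end
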